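import Mathlib

/-!
# Sketch — crux stmt-AtomisticToContinuum-13958 (`PhononSlackCertificates.NearFieldConvexity`),
ideator 2, round 1 — card `zero-virial-gauge-flux`

The crux asks for a boundary charge `C · #∂₄Ω` at FIXED radius `4`, with `C` depending on `(δ, η)`
only.  In the exact prestress split of the Lennard-Jones site energy about a force-balanced,
zero-stress reference (squared bond lengths, card `prestress-split-korn` of the sibling crux
13603), the one term that does not localise trivially is the LINEAR (flux) term; the sibling line
localises it only to `O(R^{5/2})` per mesoscopic ball and therefore carries a slack `θ·#Ω` that
13958 does not allow.  The statements below are the algebraic heart of the proposed repair: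

* `GaugeSplit` (PROVED, `gaugeSplit_holds`): the frame-free ω-part of one site splits, for ANY
  linear isometry `Q`, into a linear term and a stress form — so every site may use ITS OWN frame.
* `OwnGaugeLinearTerm` (PROVED): with force balance `∑ ω_j • e_j = 0` the site's own misfit drops out
  of its linear term; only the misfits of its partners, read in the site's gauge, remain.
* `GaugeCommutatorIdentity` (stated): summing the own-gauge linear terms of a finite force-balanced
  configuration with site-dependent gauges `(Q_i, τ_i)` gives EXACTLY (commutator `[ω, Q]` paired
  with each atom's OWN misfit `v_j(j)`, a second-order quantity) + (a pure-gauge term), with no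
  global frame anywhere — the term the sibling line found "dead for wound fields" never forms.
* `ZeroVirialKillsAffine` (PROVED): at a site with zero virial `∑ ω_j ⟪e_j, M e_j⟫ = 0 ∀ M`, the
  own-gauge linear term vanishes on affine misfits — the reason the pure-gauge term is of
  curvature order (third bond moment, alternating between hcp sublattices) rather than strain order.
* `DiscreteGaussWork` (stated): boundary work of a divergence-free antisymmetric bond flux equals the
  interior pairing of the flux with DIFFERENCES — the bookkeeping used at `∂Ω`.

Everything is over `EuclideanSpace ℝ (Fin 3)`, finite index types and `Finset` sums; no project
declaration is needed for these identities (the card's Leans-on list names the tree declarations the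
LINE will use: `lennardJones`, `barlowStacking`, `IsTwoShellGood`, …).
-/

noncomputable section

open scoped BigOperators RealInnerProductSpace

namespace Summit.AtomisticToContinuum.Crystallization.Cruxes.NearFieldConvexity.IdeatorTwo

local notation "E3" => EuclideanSpace ℝ (Fin 3)

/-- **Sitewise gauge split.** For the bond data of one site (weights `ω j = V'(r*_j)/(2 r*_j)`,
reference bonds `e j`, actual bonds `b j`) and ANY linear isometry `Q`:
`∑ ω (‖b‖² − ‖e‖²) = 2 ∑ ω ⟪Q e, b − Q e⟫ + ∑ ω ‖b − Q e‖²` — the frame-free ω-part of the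
prestress split equals (linear term in the frame `Q`) + (stress form in the frame `Q`). [folklore] -/
def GaugeSplit : Prop :=
  ∀ (n : ℕ) (ω : Fin n → ℝ) (e b : Fin n → E3) (Q : E3 →ₗᵢ[ℝ] E3),
    ∑ j, ω j * (‖b j‖ ^ 2 - ‖e j‖ ^ 2) =
      2 * ∑ j, ω j * ⟪Q (e j), b j - Q (e j)⟫ + ∑ j, ω j * ‖b j - Q (e j)‖ ^ 2

theorem gaugeSplit_holds : GaugeSplit := by
  intro n ω e b Q
  have key : ∀ j, ‖b j‖ ^ 2 - ‖e j‖ ^ 2 =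
      2 * ⟪Q (e j), b j - Q (e j)⟫ + ‖b j - Q (e j)‖ ^ 2 := by
    intro j
    have h1 : ‖Q (e j)‖ = ‖e j‖ := Q.norm_map (e j)
    have h2 : b j = Q (e j) + (b j - Q (e j)) := by abel
    have h3 : ‖b j‖ ^ 2 = ‖Q (e j)‖ ^ 2 + 2 * ⟪Q (e j), b j - Q (e j)⟫ + ‖b j - Q (e j)‖ ^ 2 := by
      conv_lhs => rw [h2]
      rw [norm_add_sq_real]
    rw [h3, h1]; ring
  simp_rw [key, mul_add, Finset.sum_add_distrib, Finset.mul_sum]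
  congr 1
  refine Finset.sum_congr rfl fun j _ => ?_
  ring

/-- **Own-gauge linear term.** If the reference bonds at a site balance, `∑ ω_j • e_j = 0`, then
the site's own misfit `v0` drops out of its linear term read in any frame `Q`:
`∑ ω_j ⟪Q e_j, v_j − v0⟫ = ∑ ω_j ⟪Q e_j, v_j⟫`. [folklore] -/
def OwnGaugeLinearTerm : Prop :=
  ∀ (n : ℕ) (ω : Fin n → ℝ) (e v : Fin n → E3) (v0 : E3) (Q : E3 →ₗᵢ[ℝ] E3),
    ∑ j, ω j • e j = 0 →
      ∑ j, ω j * ⟪Q (e j), v j - v0⟫ = ∑ j, ω j * ⟪Q (e j), v j⟫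

theorem ownGaugeLinearTerm_holds : OwnGaugeLinearTerm := by
  intro n ω e v v0 Q hbal
  have hQ : ∑ j, ω j • Q (e j) = 0 := by
    have : Q (∑ j, ω j • e j) = ∑ j, ω j • Q (e j) := by
      rw [map_sum]
      refine Finset.sum_congr rfl fun j _ => ?_
      rw [LinearIsometry.map_smul]
    rw [← this, hbal, map_zero]
  have hsplit : ∀ j, ω j * ⟪Q (e j), v j - v0⟫ =
      ω j * ⟪Q (e j), v j⟫ - ⟪ω j • Q (e j), v0⟫ := by
    intro j
    rw [inner_sub_right, real_inner_smul_left]; ring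
  simp_rw [hsplit, Finset.sum_sub_distrib]
  rw [← sum_inner, hQ, inner_zero_left, sub_zero]

/-- **Gauge–commutator identity** (the lever's algebraic heart).  A finite reference `y` with
symmetric bond weights `ω` in force balance at every site, an arbitrary deformed configuration `x`,
and ARBITRARY site gauges `(Q i, τ i)`; own misfit of atom `j`: `v j := x j − τ j − Q j (y j)`.
Then the sum of the own-gauge linear terms is EXACTLY a commutator term (weights paired with gauge
DIFFERENCES of partners, against each atom's own misfit) plus a pure-gauge term (depends on the
gauges and the reference only through `τ j − τ i + (Q j − Q i)(y j)`):
`∑_i ∑_j ω_ij ⟪Q_i(y_j − y_i), (x_j − x_i) − Q_i(y_j − y_i)⟫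
   = ∑_j ∑_i ω_ij ⟪Q_i(y_j − y_i) − Q_j(y_j − y_i), v_j⟫
   + ∑_i ∑_j ω_ij ⟪Q_i(y_j − y_i), τ_j − τ_i + (Q_j(y_j) − Q_i(y_j))⟫`.
No global frame enters; with smooth gauges the first sum is (misfit) × (gauge gradient), the second
is controlled by the zero site virial (`ZeroVirialKillsAffine`). [folklore] -/
def GaugeCommutatorIdentity : Prop :=
  ∀ (N : ℕ) (ω : Fin N → Fin N → ℝ) (y x : Fin N → E3) (Q : Fin N → (E3 →ₗᵢ[ℝ] E3))
    (τ : Fin N → E3),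
    (∀ i j, ω i j = ω j i) →
    (∀ i, ∑ j, ω i j • (y j - y i) = 0) →
      ∑ i, ∑ j, ω i j * ⟪Q i (y j - y i), (x j - x i) - Q i (y j - y i)⟫ =
        (∑ j, ∑ i, ω i j * ⟪Q i (y j - y i) - Q j (y j - y i), x j - τ j - Q j (y j)⟫) +
        ∑ i, ∑ j, ω i j * ⟪Q i (y j - y i), τ j - τ i + (Q j (y j) - Q i (y j))⟫

/-- **Zero site virial kills affine misfits.**  If the reference bonds at a site have zero virial
as a bilinear form, `∑ ω_j ⟪e_j, M e_j⟫ = 0` for every linear `M`, then for every frame `Q` and every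
linear `M` the own-gauge linear term of the affine misfit `j ↦ Q (M e_j)` vanishes. [folklore] -/
def ZeroVirialKillsAffine : Prop :=
  ∀ (n : ℕ) (ω : Fin n → ℝ) (e : Fin n → E3) (Q : E3 →ₗᵢ[ℝ] E3) (M : E3 →ₗ[ℝ] E3),
    (∀ M' : E3 →ₗ[ℝ] E3, ∑ j, ω j * ⟪e j, M' (e j)⟫ = 0) →
      ∑ j, ω j * ⟪Q (e j), Q (M (e j))⟫ = 0

theorem zeroVirialKillsAffine_holds : ZeroVirialKillsAffine := by
  intro n ω e Q M hW
  have h : ∀ j, ⟪Q (e j), Q (M (e j))⟫ = ⟪e j, M (e j)⟫ := fun j => Q.inner_map_map _ _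
  simp_rw [h]
  exact hW M

/-- **Discrete Gauss identity for boundary work.**  For an antisymmetric bond flux `φ` that is
divergence-free at every site of a finite set `A` (`∑_j φ i j = 0` for `i ∈ A`; e.g. the equilibrium
bond forces `ω_ij (y_j − y_i)` of the reference), the work of the flux ACROSS `∂A` against a field
`w` equals half the interior pairing of the flux with the DIFFERENCES of `w`:
`∑_{i∈A} ∑_{j∉A} ⟪φ i j, w i⟫ = ½ ∑_{i∈A} ∑_{j∈A} ⟪φ i j, w j − w i⟫`. [folklore] -/
def DiscreteGaussWork : Prop :=
  ∀ (N : ℕ) (φ : Fin N → Fin N → E3) (w : Fin N → E3) (A : Finset (Fin N)),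
    (∀ i j, φ j i = -φ i j) →
    (∀ i ∈ A, ∑ j, φ i j = 0) →
      ∑ i ∈ A, ∑ j ∈ Aᶜ, ⟪φ i j, w i⟫ =
        (1 / 2 : ℝ) * ∑ i ∈ A, ∑ j ∈ A, ⟪φ i j, w j - w i⟫

end Summit.AtomisticToContinuum.Crystallization.Cruxes.NearFieldConvexity.IdeatorTwo
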